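import Summits.QuantumFields.YangMills.Theorems.UnitScaleTiltFluctuationComparisonRegPrGlobalSlackCanonicalPolymersCoreRowsV4
import Summits.QuantumFields.YangMills.Theorems.UnitScaleTiltFluctuationComparisonRegPrGlobalSlackCanonicalPolymersCoreSizesV4
import Summits.QuantumFields.YangMills.Theorems.UnitScaleTiltFluctuationComparisonRegPrGlobalSlackKernelMatchingOn
import HarnessLib

/-!
# `UnitScaleTiltFluctuationComparisonRegPrGlobalSlackCanonicalPolymersCoreSplitV4` — THE v4 TWIN (★★OWNER RULING g26-№14 (F-2b); P22b polymer-step branch, width seat ym-ust-20520-w2 g4; skeleton v5kD; record-free decls imported from `…GlobalSlackCanonicalPolymersCoreSplit`) of `…GlobalSlackCanonicalPolymersCoreSplit` — KING'S PER-POLYMER SLACK ROW FOR THE CANONICAL TERM FUNCTION SPLITS INTO A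
# NEWBORN-TERM ROW AND AN OLD-TERM ROW, EACH STATED ON THE DISPLAYED FIELDS OF THE STEP RECORDS (crux `FluctuationComparisonRegPrIntL`, stmt-QuantumFields-20520,
# skeleton v5kC STUBS 3⁗χ / (i*)χ; width seat ym-ust-20520-w2 on (i*)χ)

WHY.  The producer of both analytic χ-stubs consumes ONE two-run row: `GlobalSlackKernelMatchingOn.PolymerCauchyMinAtWSlackOn S D PT …` for the CANONICAL term function
`PT := canonPTRows q` at `D := dataOfCoreRows q (canonPolymerRows q)` (`q` the family of data cores).  By DEFINITION (`…CanonicalPolymersCore`) the canonical term of a point set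
at lattice level `k+1` is either the NEWBORN term of a retained domain `X` (`newTermRows q K k X W = Re jet26(Ψ_X)(Bcfg_X) − far_X` for the step charts AND the G3D-07 charts
`Λc` — the displayed `hPY`/`hPYZ` identity) or the OLD term of a block `y` of a level `i ≤ k` (`oldTermRows q K k i y W`, the `(y;n;c)`-indexed sum of the displayed
values `oldVal`).  The two-run matching is domain ↦ transported domain (`domCast`, `refineSet_domSet`) at the new level and block ↦ lifted block (`liftSite`,
`refineSet_blockSet`) at the old levels (lane A's `locMatched_canonRows`).  So the polymer row is EQUIVALENTLY two rows, each on DISPLAYED-DEFINED objects: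

* §1 **`NewTermSlackOnRows S q b₀ p₀ κ₁ w a σ C`** — at the top term level of every lattice level `k+1 = K − n`, the newborn terms of the two runs at matched retained domains
  `X` / `domCast X` and matched fields differ, up to a datum-independent shift, by `C·e^{−κ₁·dj X}·(w(n)·L^{−a(1+k)} + θ(n)^σ)` on doubly-`S`-good window data;
  **`OldTermSlackOnRows S q b₀ p₀ κ₁ w a σ C`** — at every old term level `1 + j ≤ k`, the old terms at matched blocks `y` / `liftSite y` differ by
  `C·e^{−κ₁·𝓛}·L^{−4(k−j)}·(w(n)·L^{−a(1+j)} + θ(n)^σ)` (hypothesis schemas, never asserted);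
* §2 `canonPTRows_level_cast` (the level of a shifted field is determined up to the modulus identity) and **`polymerCauchyMinAtWSlackOn_of_newOldRows`**:
  `NewTermSlackOnRows … C₁ ∧ OldTermSlackOnRows … C₂ ⟹ PolymerCauchyMinAtWSlackOn S (dataOfCoreRows q (canonPolymerRows q)) (canonPTRows q) b₀ p₀ κ₁ w a σ (max C₁ C₂)`.
UPSHOT.  With ★r1 g4's count-form On-producer and the (i*)χ polymer socket (`…CanonicalOnChiPolymer`, this seat), (i*)χ ⇐ these two rows at `S :=` print's χ, `κ₁ := 𝔠.κ`,
`w := θ²`, `σ := 7`; the newborn row reads only `Ψ`, `Bcfg`, `far`, `Λc` of the two runs' step records at matched steps (the objects King's kernel matching compares — no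
(M1), no (M5) needed to STATE it), the old row reads only `oldVal` (whose identification with birth jets, (M1), is what a kernel-level proof of it would need).
Bookkeeping only; nothing of [Balaban1985UV3]/[King1986] is asserted; no numerics; registry untouched (`--supports stmt-QuantumFields-20520`).  YM₃ on the torus is a
rung of the ladder, not the Clay problem; nothing here is a claim about the crux or the gap.

References: T. Bałaban, CMP 102 (1985) 255–275 [Balaban1985UV3] ((33) p.264, (43)–(44) pp.266–267, (47) p.267, (57)–(61) pp.270–271); CMP 109 (1987) 249–301
[Balaban1987RG1] ((0.1) p.251); C. King, CMP 102 (1986) 649–677 [King1986] (Thm 3.4 (3.9) p.656, Prop. 3.6 (3.56) p.662).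
-/

set_option autoImplicit false

noncomputable section

namespace Summit.QuantumFields.YangMills.Theorems.GlobalSlackCanonicalPolymers

open scoped BigOperators
open Finset
open Literature.MathematicalPhysics.QuantumFieldTheory.Balaban1983to89
open Literature.MathematicalPhysics.QuantumFieldTheory.Balaban1983to89.T3ContinuumYM3Torus
open Literature.MathematicalPhysics.QuantumFieldTheory.Balaban1983to89.T3UnitScaleTilt (θBal)
open Literature.MathematicalPhysics.QuantumFieldTheory.Balaban1983to89.T3LevelShift (fieldShift)
open Literature.MathematicalPhysics.QuantumFieldTheory.Balaban1983to89.T3AlphaInputsAC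
open Literature.MathematicalPhysics.QuantumFieldTheory.Balaban1983to89.T3AlphaPolymerSocket
open Literature.MathematicalPhysics.QuantumFieldTheory.Balaban1983to89.T3AlphaInputsACTwoRunLevel
open Literature.MathematicalPhysics.QuantumFieldTheory.Balaban1983to89.TreeLengthTorus (tsys TPt)
open Literature.MathematicalPhysics.QuantumFieldTheory.Balaban1985CMP102
open Literature.MathematicalPhysics.QuantumFieldTheory.Balaban1985CMP102.Setting
open Summit.QuantumFields.Balaban3D.Carriers
open Summit.QuantumFields.Balaban3D.Proofs.Primitives
open Summit.QuantumFields.YangMills.Theorems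
open Summit.QuantumFields.YangMills.Theorems.GlobalSlackKernelMatchingOn (WinPred PolymerCauchyMinAtWSlackOn)

variable {F : T3Family} {𝔠 : AlphaConsts F.L (suGroupModel 2).N} {γ : ℝ} {hγ : 0 < γ} {hγ1 : γ ≤ (min 𝔠.gamma0 1) ^ 2}

/-! ## §1 The newborn-term row and the old-term row of the two-run comparison, on displayed-defined objects -/

/-- **THE NEWBORN-TERM TWO-RUN ROW ON `S`** (hypothesis schema, never asserted).  For every lattice level `K − n = k + 1` of run `K` (height `n`), every window datum `V`
that is `S`-good for both runs and every retained domain `X` of step `k` of run `K` (trivial history): the newborn term of run `K+1` at the transported domain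
`domCast X` (step `k+1`) and the field `V` read at level `k+2`, minus the newborn term of run `K` at `X` and `V` read at level `k+1`, minus a datum-independent
shift, is at most `C·e^{−κ₁·dj X}·(w(n)·L^{−a(1+k)} + θ(n)^σ)` — the top-level slice of King's per-polymer slack row, stated on the step records' displayed
`Ψ`, `Bcfg`, `far`, `Λc` (`newTermRows`). [cite: King1986, Prop. 3.6 (3.56) p.662, Thm 3.4 (3.9) p.656; Balaban1985UV3, (33) p.264, (59)-(61) pp.270-271, (47) p.267] -/
def NewTermSlackOnRows (S : WinPred F) (q : ∀ K, AlphaInputsT3AC.PkgCoreRows F 𝔠 γ hγ hγ1 K) (b₀ p₀ κ₁ : ℝ) (w : ℕ → ℝ) (a : ℝ) (σ : ℕ) (C : ℝ) : Prop :=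
  ∃ c : (K k : ℕ) → (tsys 3 (nblkOf (SK F 𝔠 γ hγ hγ1 K) 𝔠.lane.carrier k)).Dom → ℝ,
    ∀ (K n : ℕ) (h : n ≤ K) (k : ℕ) (hk : K - n = k + 1),
      ∀ V : GaugeField (F.P n) 0 (Matrix.specialUnitaryGroup (Fin 2) ℂ), PlaqSmall (θBal F.L γ b₀ p₀ n) V →
        S K n h V → S (K + 1) n (h.trans (Nat.le_succ K)) V →
        ∀ X ∈ newDomsRows q K k (Hist.triv (F.P K) (k + 1)),
          |newTermRows q (K + 1) (k + 1) (domCast (nblkOf_succ_eq (hγ := hγ) (hγ1 := hγ1) K k) X)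
              (fieldShift (F.sitesPerDir_eq (m := F.m) (K := K + 1) (j := k + 1 + 1) (m' := F.m) (K' := n) (j' := 0) (by omega)) V) -
            newTermRows q K k X
              (fieldShift (F.sitesPerDir_eq (m := F.m) (K := K) (j := k + 1) (m' := F.m) (K' := n) (j' := 0) (by omega)) V) -
            c K k X| ≤
          C * Real.exp (-κ₁ * (tsys 3 (nblkOf (SK F 𝔠 γ hγ hγ1 K) 𝔠.lane.carrier k)).dj X) *
            (w n * (((F.L : ℝ) ^ (1 + k))⁻¹) ^ a + θBal F.L γ b₀ p₀ n ^ σ)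

/-- **THE OLD-TERM TWO-RUN ROW ON `S`** (hypothesis schema, never asserted).  For every lattice level `K − n = k + 1` of run `K`, every old term level `1 + j ≤ k`, every
doubly-`S`-good window datum `V` and every block `y` of level `1 + j` (trivial history: the big-block corners): the old term of run `K+1` at the lifted block
`liftSite y` (level `2 + j`, step `k+1`, field read at level `k+2`) minus the old term of run `K` at `y` (step `k`, level `k+1`), minus a datum-independent shift, is at
most `C·e^{−κ₁·𝓛_K(block y)}·L^{−4(k−j)}·(w(n)·L^{−a(1+j)} + θ(n)^σ)` — the old slices of King's per-polymer slack row, stated on the displayed values `oldVal`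
(`oldTermRows`). [cite: King1986, Thm 3.4 (3.9) p.656, Prop. 3.9 (3.71) p.665; Balaban1985UV3, (43)-(44) pp.266-267, (47) p.267] -/
def OldTermSlackOnRows (S : WinPred F) (q : ∀ K, AlphaInputsT3AC.PkgCoreRows F 𝔠 γ hγ hγ1 K) (b₀ p₀ κ₁ : ℝ) (w : ℕ → ℝ) (a : ℝ) (σ : ℕ) (C : ℝ) : Prop :=
  ∃ c : (K k i : ℕ) → Site (F.P K) i → ℝ,
    ∀ (K n : ℕ) (h : n ≤ K) (k : ℕ) (hk : K - n = k + 1), ∀ j : ℕ, j < k →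
      ∀ V : GaugeField (F.P n) 0 (Matrix.specialUnitaryGroup (Fin 2) ℂ), PlaqSmall (θBal F.L γ b₀ p₀ n) V →
        S K n h V → S (K + 1) n (h.trans (Nat.le_succ K)) V →
        ∀ y ∈ oldBlocks 𝔠.lane.carrier.M₁ (rcolOf (SK F 𝔠 γ hγ hγ1 K) 𝔠.lane.carrier) (Hist.triv (F.P K) (k + 1)) (1 + j),
          |oldTermRows q (K + 1) (k + 1) (1 + j + 1) (liftSite F K (1 + j) y)
              (fieldShift (F.sitesPerDir_eq (m := F.m) (K := K + 1) (j := k + 1 + 1) (m' := F.m) (K' := n) (j' := 0) (by omega)) V) -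
            oldTermRows q K k (1 + j) y
              (fieldShift (F.sitesPerDir_eq (m := F.m) (K := K) (j := k + 1) (m' := F.m) (K' := n) (j' := 0) (by omega)) V) -
            c K k (1 + j) y| ≤
          C * Real.exp (-κ₁ * canonTreeLenRows q K (1 + j) (blockSet K (1 + j) y)) * (((F.L : ℝ) ^ (k - j))⁻¹) ^ 4 *
            (w n * (((F.L : ℝ) ^ (1 + j))⁻¹) ^ a + θBal F.L γ b₀ p₀ n ^ σ)

/-! ## §2 The polymer row from the two rows -/

/-- The canonical term read at a shifted field depends on the lattice level only through the modulus identity: along `j₁ = j₂` the two readings agree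
(`subst`; the two modulus proofs then coincide). [cite: Balaban1987RG1, (0.1) p.251] -/
theorem canonPTRows_level_cast (q : ∀ K, AlphaInputsT3AC.PkgCoreRows F 𝔠 γ hγ hγ1 K) (K : ℕ) {j₁ j₂ : ℕ} (e : j₁ = j₂) (i : ℕ) (Y : Set (Site (F.P K) 0))
    {m' K' j' : ℕ} (h₁ : (F.PP F.m K).sitesPerDir j₁ = (F.PP m' K').sitesPerDir j') (h₂ : (F.PP F.m K).sitesPerDir j₂ = (F.PP m' K').sitesPerDir j')
    (V : GaugeField (F.PP m' K') j' (Matrix.specialUnitaryGroup (Fin 2) ℂ)) :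
    canonPTRows q K j₁ i Y (fieldShift h₁ V) = canonPTRows q K j₂ i Y (fieldShift h₂ V) := by
  subst e; rfl

/-- A rate weight is monotone in its constant: `C ≤ C'` and a nonnegative tail give the row's right side at `C'`. [folklore] -/
private theorem budget_mono {C C' e x t : ℝ} (hCC : C ≤ C') (he : 0 ≤ e) (hx : 0 ≤ x) (ht : 0 ≤ t) :
    C * e * x * t ≤ C' * e * x * t :=
  mul_le_mul_of_nonneg_right (mul_le_mul_of_nonneg_right (mul_le_mul_of_nonneg_right hCC he) hx) ht

open Classical in
/-- **KING'S PER-POLYMER SLACK ROW FOR THE CANONICAL TERM FUNCTION FROM THE NEWBORN-TERM ROW AND THE OLD-TERM ROW** (same sub-predicate `S`, profile, rate, weight and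
exponent; constant `max C₁ C₂`; requires `0 ≤ w`, `0 ≤ θ`).  At `(K, n, j, Y)`: name the lattice level `K − n = k + 1` (`canonPTRows_level_cast`); at the top term level
`j = k` the listed point set is `domSet X` of a retained domain and both terms are newborn terms (`canonPTRows_new_eq`, `refineSet_domSet`, `canonTreeLenRows_domSet`); below
it the point set is `blockSet y` of a corner block and both terms are old terms (`canonPTRows_old_eq`, `refineSet_blockSet`); the shifts are the rows' shifts re-indexed by
point sets (`domSet_injective`, `blockSet_injective`). [cite: King1986, Thm 3.4 (3.9) p.656, Prop. 3.6 (3.56) p.662; Balaban1985UV3, (43)-(44) pp.266-267, (59) p.270] -/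
theorem polymerCauchyMinAtWSlackOn_of_newOldRows (S : WinPred F) (q : ∀ K, AlphaInputsT3AC.PkgCoreRows F 𝔠 γ hγ hγ1 K) {b₀ p₀ κ₁ a C₁ C₂ : ℝ} {w : ℕ → ℝ} {σ : ℕ}
    (hw : ∀ n, 0 ≤ w n) (hθ : ∀ n, 0 ≤ θBal F.L γ b₀ p₀ n)
    (hN : NewTermSlackOnRows S q b₀ p₀ κ₁ w a σ C₁) (hO : OldTermSlackOnRows S q b₀ p₀ κ₁ w a σ C₂) :
    PolymerCauchyMinAtWSlackOn S (AlphaInputsT3AC.dataOfCoreRows q (canonPolymerRows q)) (canonPTRows q) b₀ p₀ κ₁ w a σ (max C₁ C₂) := by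
  obtain ⟨cN, hcN⟩ := hN
  obtain ⟨cO, hcO⟩ := hO
  have hL0 : (0 : ℝ) < (F.L : ℝ) := by exact_mod_cast (zero_lt_one.trans F.hL.2)
  -- the shift, re-indexed by point sets: the newborn shift at the top term level, the old shift below it
  refine ⟨fun K n j Y =>
    if j + 1 = K - n then
      ∑ X ∈ (newDomsRows q K (K - n - 1) (Hist.triv (F.P K) (K - n - 1 + 1))).filter
        (fun X => domSet (F := F) 𝔠.lane.carrier.M₁ K (K - n - 1) X = Y), cN K (K - n - 1) X
    else
      ∑ y ∈ (oldBlocks 𝔠.lane.carrier.M₁ (rcolOf (SK F 𝔠 γ hγ hγ1 K) 𝔠.lane.carrier) (Hist.triv (F.P K) (K - n - 1 + 1)) (1 + j)).filter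
        (fun y => blockSet K (1 + j) y = Y), cO K (K - n - 1) (1 + j) y, ?_⟩
  intro K n hn j hj V hV hS hS' Y hY
  dsimp only
  -- name the lattice level `K − n = (K − n − 1) + 1`
  have hk : K - n = K - n - 1 + 1 := by omega
  have hk' : K + 1 - n = K - n - 1 + 1 + 1 := by omega
  have hkK : K - n - 1 + 1 ≤ K := by omega
  have hkK' : K - n - 1 + 1 + 1 ≤ K + 1 := by omega
  have hkm : K - n - 1 ≤ F.m + K := by have := F.hm; omega
  rw [canonPTRows_level_cast q (K + 1) hk' _ _ _
      (F.sitesPerDir_eq (m := F.m) (K := K + 1) (j := K - n - 1 + 1 + 1) (m' := F.m) (K' := n) (j' := 0) (by omega)) V,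
    canonPTRows_level_cast q K hk _ _ _
      (F.sitesPerDir_eq (m := F.m) (K := K) (j := K - n - 1 + 1) (m' := F.m) (K' := n) (j' := 0) (by omega)) V]
  change Y ∈ canonLocRows q K (K - n) (Hist.triv (F.P K) (K - n)) (1 + j) at hY
  change _ ≤ max C₁ C₂ * Real.exp (-κ₁ * canonTreeLenRows q K (1 + j) Y) * (((F.L : ℝ) ^ (K - n - 1 - j))⁻¹) ^ 4 *
    (w n * (((F.L : ℝ) ^ (1 + j))⁻¹) ^ a + θBal F.L γ b₀ p₀ n ^ σ)
  rw [hk] at hY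
  have htail : 0 ≤ w n * (((F.L : ℝ) ^ (1 + j))⁻¹) ^ a + θBal F.L γ b₀ p₀ n ^ σ :=
    add_nonneg (mul_nonneg (hw n) (Real.rpow_nonneg (by positivity) _)) (pow_nonneg (hθ n) σ)
  by_cases hjk : j = K - n - 1
  · -- the TOP term level: newborn terms at matched retained domains
    subst hjk
    have e2 : 1 + (K - n - 1 + 1) = K - n - 1 + 1 + 1 := by omega
    have e1 : 1 + (K - n - 1) = K - n - 1 + 1 := by omega
    rw [e2, e1]
    rw [e1] at hY htail
    simp only [canonLocRows, if_pos hkK, ite_true, mem_image] at hY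
    obtain ⟨X, hX, rfl⟩ := hY
    have hN := nblkOf_succ_eq (F := F) (𝔠 := 𝔠) (γ := γ) (hγ := hγ) (hγ1 := hγ1) K (K - n - 1)
    have hX' : domCast hN X ∈ newDomsRows q (K + 1) (K - n - 1 + 1) (Hist.triv (F.P (K + 1)) (K - n - 1 + 1 + 1)) := by
      rw [mem_newDomsRows_triv_iff] at hX ⊢
      rw [dj_domCast, rretOf_succ_eq K (K - n - 1) (by omega)]
      exact hX
    rw [refineSet_domSet hN _ K (K - n - 1) hkm X, canonPTRows_new_eq q (K + 1) (K - n - 1 + 1) hkK' (domCast hN X) hX',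
      canonPTRows_new_eq q K (K - n - 1) hkK X hX, canonTreeLenRows_domSet q K (K - n - 1) hkm X]
    -- the shift is the newborn shift at `X`
    have hfil : ((newDomsRows q K (K - n - 1) (Hist.triv (F.P K) (K - n - 1 + 1))).filter
        fun X' => domSet (F := F) 𝔠.lane.carrier.M₁ K (K - n - 1) X' = domSet (F := F) 𝔠.lane.carrier.M₁ K (K - n - 1) X) = {X} := by
      ext X'
      simp only [mem_filter, mem_singleton]
      exact ⟨fun h => domSet_injective K (K - n - 1) hkm h.2, fun h => by subst h; exact ⟨hX, rfl⟩⟩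
    rw [if_pos (by omega), hfil, sum_singleton]
    have hxk : (((F.L : ℝ) ^ (K - n - 1 - (K - n - 1)))⁻¹) ^ 4 = 1 := by simp
    rw [hxk, mul_one]
    have key := hcN K n hn (K - n - 1) hk V hV hS hS' X hX
    rw [e1] at key
    refine key.trans ?_
    have he : 0 ≤ Real.exp (-κ₁ * (tsys 3 (nblkOf (SK F 𝔠 γ hγ hγ1 K) 𝔠.lane.carrier (K - n - 1))).dj X) := (Real.exp_pos _).le
    exact mul_le_mul_of_nonneg_right (mul_le_mul_of_nonneg_right (le_max_left _ _) he) htail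
  · -- an OLD term level: old terms at matched corner blocks
    have hjlt : j < K - n - 1 := by omega
    have hi : 1 + j ∈ Finset.Icc 1 (K - n - 1) := Finset.mem_Icc.mpr ⟨by omega, by omega⟩
    have hi' : 1 + j + 1 ∈ Finset.Icc 1 (K - n - 1 + 1) := Finset.mem_Icc.mpr ⟨by omega, by omega⟩
    have hik : ¬ (1 + j = K - n - 1 + 1) := by omega
    have him : 1 + j ≤ F.m + K := by omega
    simp only [canonLocRows, if_pos hkK, if_neg hik, if_pos hi, mem_image] at hY
    obtain ⟨y, hy, rfl⟩ := hY
    have hy' : liftSite F K (1 + j) y ∈ oldBlocks 𝔠.lane.carrier.M₁ (rcolOf (SK F 𝔠 γ hγ hγ1 (K + 1)) 𝔠.lane.carrier)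
        (Hist.triv (F.P (K + 1)) (K - n - 1 + 1 + 1)) (1 + j + 1) := by
      rw [mem_oldBlocks_triv_iff] at hy ⊢
      exact (isCorner_liftSite_iff _ K (1 + j) y).mpr hy
    rw [refineSet_blockSet K (1 + j) him y, show 1 + (j + 1) = 1 + j + 1 by omega,
      canonPTRows_old_eq q (K + 1) (K - n - 1 + 1) hkK' (1 + j + 1) hi' (liftSite F K (1 + j) y) hy',
      canonPTRows_old_eq q K (K - n - 1) hkK (1 + j) hi y hy]
    -- the shift is the old shift at `y`
    have hfil : ((oldBlocks 𝔠.lane.carrier.M₁ (rcolOf (SK F 𝔠 γ hγ hγ1 K) 𝔠.lane.carrier) (Hist.triv (F.P K) (K - n - 1 + 1)) (1 + j)).filter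
        fun y' => blockSet K (1 + j) y' = blockSet K (1 + j) y) = {y} := by
      ext y'
      simp only [mem_filter, mem_singleton]
      exact ⟨fun h => blockSet_injective K (1 + j) him h.2, fun h => by subst h; exact ⟨hy, rfl⟩⟩
    rw [if_neg (by omega), hfil, sum_singleton]
    have key := hcO K n hn (K - n - 1) hk j hjlt V hV hS hS' y hy
    refine key.trans ?_
    exact budget_mono (le_max_right _ _) (Real.exp_pos _).le (by positivity) htail

end Summit.QuantumFields.YangMills.Theorems.GlobalSlackCanonicalPolymers

end
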